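import Summits.QuantumFields.QCD.Theses.WilsonQuarkChessboard
import Summits.QuantumFields.QCD.Theorems.WilsonQuarkChessboardQuarkChessboard
import Summits.QuantumFields.QCD.Theorems.QuarksAsStableActionWilsonQuarkStabilityStubNormDetChainBlock
import Literature.MathematicalPhysics.QuantumLattice.WilsonDiracAP
import Summits.QuantumFields.QCD.Theorems.WilsonQuarkChessboardFlatCellOptimalStubCyclicHolderEven
import Summits.QuantumFields.QCD.Theorems.WilsonQuarkChessboardFlatCellOptimalStubStaticSliceBoundAllN
import Summits.QuantumFields.QCD.Theorems.WilsonQuarkChessboardFlatCellOptimalStubStaticIterateAllN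

/-!
# Skeleton v7 for crux `FlatCellOptimal` — stmt-QuantumFields-9307, line `registered`
(route `WilsonQuarkChessboard`, rank 3; sub-problem `QCD`)

Lead c1 = `prover-line-stmt-QuantumFields-9307-c1-0`, 2026-08-17 (v1 = the planner's BC3 birth skeleton; v2–v5 = lead 0,
whose LOCAL HALF `LocalNormGain`/`LocalFlatOptimum` is a tree theorem in the computational lane, p169601/p169674, 40 files;
v6 = lead c1, axiom-clean bookkeeping of that state).

## v8 (2026-08-17T20Z): ALL THREE v7 STUBS LANDED (wave 1, first try): `stub_cyclicHolderEven` p172998, `stub_staticSliceBoundAllN`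
p173204, `stub_staticIterateAllN` p173312 (namespace `Summit.QuantumFields.QCD.Cruxes.FlatCellOptimal.Diamag`).  This file is now
SORRY-FREE and kernel-clean; the closing Theorems file is `Theorems/WilsonQuarkChessboardFlatCellOptimal.lean`
(`wilsonQuarkChessboardFlatCellOptimal_proof`, with `wilsonQuarkChessboardQuarkDiamagnetism_proof` for item 9310).

## v7 (2026-08-17T19Z): THE FAR HALF IS RESHAPED INTO A DIAMAGNETIC INEQUALITY ON EVEN TORI — three registered port stubs

The one open stub of v6, `stub_farFromFlat` (a global variational inequality over `U(N)^32`, "no method known"),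
follows — together with the local half, the whole crux K, and the sibling item `QuarkDiamagnetism` — from the
**diamagnetic inequality for `r = 1` Wilson fermions on EVEN tori**: for every `N`, every even `L`, every `U(N)` link
field `V` (seam signs included) and every `m > −1`,
`‖det D_W[V]‖ ≤ ‖det D_W[T]‖`, `T` = the all-seams antiperiodic pattern (`−1` on `x_μ = −1`, `1` elsewhere).
Mechanism (Fröhlich–Israel–Lieb–Simon Gaussian domination through BOND reflections = Lüscher's transfer matrix; the
method of Lieb's flux-phase theorem, whose extremal flux is here ZERO flux with antiperiodic quarks): Lüscher's
transfer-matrix form `det D_W[V] = (∏_t det E_t) · det(1 − ∏_{t<L} M_t W_t)` (tree: `wilson_det_transfer_form`, p120730,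
every `N`, every `L`, `M_t > 0` a function of the spatial links of slice `t`, `W_t` the unitary temporal transporters),
the Fock functor (`Tr Γ(X) = det(1 + X)`), and the generalised Hölder inequality for Schatten norms with `L` equal
exponents, `‖Tr ∏_{t<L} Γ(M_t) Γ(±W_t)‖^L ≤ ∏_t Tr Γ(M_t)^L` — the unitaries DROP OUT (`B_t B_tᴴ = Γ(M_t²)`), so the
determinant is dominated by the geometric mean of the STATIC fields `S⁰_s V` (slice `s` repeated, trivial temporal
links): `‖det D_W[V]‖^L ≤ ∏_s ‖det D_W[S⁰_s V]‖`; four axes in turn make every link trivial.  For ODD `L` this is the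
tree theorem `diamagnetic_odd` (crux 9736, `U(3)`); the parity enters ONLY through the Hölder step, and for even
`L = 2n` that step is the tree theorem `evenCycleChessboard` (crux 9734, p-landed, abstract matrices).  Hence the three
registered stubs of v7 are PORTS of tree theorems (`Fin 3 ↦ Fin N`, `Odd ↦ Even`):

* `stub_cyclicHolderEven` — `‖Tr ∏_{i<L} T_i u_i‖^L ≤ ∏_i Re Tr T_i^L` for positive definite `T_i`, unitary `u_i`,
  EVEN `L` (from `…CriticalLineDiamagnetismEvenCycleChessboard.evenCycleChessboard` with `B_j := T_j u_j`);
* `stub_staticSliceBoundAllN` — the time-direction static slice bound for `U(N)` fields, given the Hölder step `hH` and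
  the chain-block lemma `hE` (port of `…WilsonQuarkStabilityStubStaticSliceBound(Aux)`, whose proof never uses `Odd L`);
* `stub_staticIterateAllN` — the four-axis iteration for `U(N)` fields (port of `…WilsonQuarkStabilityStubStaticIterate`).

Composition (sorry-free below the stubs, kernel-clean — NO `native_decide`): `diamagnetic_even` ⇒ `LocalNormGain`
(η = δ = 1) and `FarFromFlat` (δ = 1, the deficit hypothesis is not needed) ⇒ `FlatCellOptimal_of hA hB hC`, with the
mass window `(−1, 1)`.  The v2–v6 local half (computational lane) is thereby superseded but stays in the tree as supports.
-/

noncomputable section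

namespace Summit.QuantumFields.QCD.Cruxes.FlatCellOptimal.Birth

open scoped BigOperators Classical Matrix ComplexConjugate ComplexOrder
open Literature.MathematicalPhysics.QuantumLattice Literature.MathematicalPhysics.QuantumFieldTheory

/-! ## Currency (verbatim the crux's `let`s, as reducible abbreviations) -/

/-- `det_AP D_W[V]`: the `r = 1` Wilson–Dirac determinant of the `U(N)` field `V` with the links
leaving the last slice `x_μ = L − 1` negated in every direction `μ` (antiperiodic quarks on all four
axes) — verbatim the crux's `let dAP`. -/
abbrev dAP {N L : ℕ} [NeZero L] (m : ℝ) (V : GaugeConfig 4 L (Matrix.unitaryGroup (Fin N) ℂ)) : ℂ :=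
  (wilsonDirac (unitaryFundamentalRep (Fin N) ℂ)
    (fun e => if (e.1 e.2).val + 1 = L then -V e else V e) m 1).det

/-- `R_c V`: the period-2 reflection tiling of the torus generated by the closed unit cell with
lowest corner `c` — verbatim the crux's `let tile`. -/
abbrev tile {N L : ℕ} (c : Site 4 L) (V : GaugeConfig 4 L (Matrix.unitaryGroup (Fin N) ℂ)) :
    GaugeConfig 4 L (Matrix.unitaryGroup (Fin N) ℂ) := fun e =>
  if (e.1 e.2 - c e.2).val % 2 = 0 then V (fun ν => c ν + (((e.1 ν - c ν).val % 2 : ℕ) : ZMod L), e.2)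
  else (V (fun ν => c ν + (((Site.shift e.1 e.2 ν - c ν).val % 2 : ℕ) : ZMod L), e.2))⁻¹

/-- The plaquette deficit `N − Re tr V_p` of the `U(N)` field `V` at the plaquette `(x; i, j)`. -/
abbrev deficit {N L : ℕ} (V : GaugeConfig 4 L (Matrix.unitaryGroup (Fin N) ℂ)) (x : Site 4 L)
    (i j : Fin 4) : ℝ :=
  (N : ℝ) - ((unitaryFundamentalRep (Fin N) ℂ) (plaquetteHolonomy V x i j)).trace.re

/-! ## The two halves of the crux (v1, unchanged) and the norm form of the local half (v2) -/

/-- **Local flat optimum (perturbative regime).** -/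
def LocalFlatOptimum : Prop :=
  ∃ η : ℝ, 0 < η ∧ ∃ δ : ℝ, 0 < δ ∧ ∀ (N L : ℕ) [NeZero L], Even L → 4 ≤ L →
    ∀ (U : GaugeConfig 4 L (Matrix.unitaryGroup (Fin N) ℂ)) (c : Site 4 L) (m : ℝ), -δ < m → m < δ →
      (∀ (x : Site 4 L) (i j : Fin 4), deficit (tile c U) x i j < η) →
        (dAP m (tile c U)).re ≤ (dAP m (1 : GaugeConfig 4 L (Matrix.unitaryGroup (Fin N) ℂ))).re

/-- **Far from flat (large-deviation regime).** -/
def FarFromFlat : Prop :=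
  ∀ η : ℝ, 0 < η → ∃ δ : ℝ, 0 < δ ∧ ∀ (N L : ℕ) [NeZero L], Even L → 4 ≤ L →
    ∀ (U : GaugeConfig 4 L (Matrix.unitaryGroup (Fin N) ℂ)) (c : Site 4 L) (m : ℝ), -δ < m → m < δ →
      (∃ (x : Site 4 L) (i j : Fin 4), η ≤ deficit (tile c U) x i j) →
        (dAP m (tile c U)).re ≤ (dAP m (1 : GaugeConfig 4 L (Matrix.unitaryGroup (Fin N) ℂ))).re

/-- **Local half in NORM form**: `‖dAP m (tile c U)‖ ≤ ‖dAP m 1‖` for η-flat tilings. -/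
def LocalNormGain : Prop :=
  ∃ η : ℝ, 0 < η ∧ ∃ δ : ℝ, 0 < δ ∧ ∀ (N L : ℕ) [NeZero L], Even L → 4 ≤ L →
    ∀ (U : GaugeConfig 4 L (Matrix.unitaryGroup (Fin N) ℂ)) (c : Site 4 L) (m : ℝ), -δ < m → m < δ →
      (∀ (x : Site 4 L) (i j : Fin 4), deficit (tile c U) x i j < η) →
        ‖dAP m (tile c U)‖ ≤ ‖dAP m (1 : GaugeConfig 4 L (Matrix.unitaryGroup (Fin N) ℂ))‖

/-! ## v7: the diamagnetic inequality on even tori and its three port stubs -/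

/-- **The diamagnetic inequality** (all `N`, all even `L`, all `m > −1`): the `r = 1` Wilson–Dirac determinant of
every `U(N)` link field is dominated in modulus by that of the all-seams antiperiodic pattern. -/
def DiamagneticEven : Prop :=
  ∀ (N L : ℕ) [NeZero L], Even L →
    ∀ (V : GaugeConfig 4 L (Matrix.unitaryGroup (Fin N) ℂ)) (m : ℝ), -1 < m →
      ‖(wilsonDirac (unitaryFundamentalRep (Fin N) ℂ) V m 1).det‖ ≤
        ‖(wilsonDirac (unitaryFundamentalRep (Fin N) ℂ)
          (fun e : Edge 4 L => if e.1 e.2 = -1 then (-1 : Matrix.unitaryGroup (Fin N) ℂ) else 1) m 1).det‖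

/-! ### Registered stubs (v7) — ALL LANDED in v8 (no `sorry` left in this file); stated EXPANDED, tree vocabulary only -/

/-- Stub A (`stub_cyclicHolderEven`): the cyclic Hölder / chessboard inequality for EVEN length — for positive
definite `T_i` and unitary `u_i` on `ZMod L`, `L` even (and `≠ 0`),
`‖Tr ∏_{i<L} T_i u_i‖^L ≤ ∏_i Re Tr T_i^L`.  (Generalised Hölder for Schatten norms with `L = 2n` equal exponents:
`evenCycleChessboard` with `B_j := T_j u_j`, `B_j B_jᴴ = T_j²`.) -/
theorem stub_cyclicHolderEven :
    ∀ (L : ℕ) [NeZero L], Even L → ∀ {k : Type} [Fintype k] [DecidableEq k] (T u : ZMod L → Matrix k k ℂ),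
      (∀ i, (T i).PosDef) → (∀ i, u i ∈ Matrix.unitaryGroup k ℂ) →
      ‖((List.range L).map fun i : ℕ => T (i : ZMod L) * u (i : ZMod L)).prod.trace‖ ^ L ≤
        ∏ i : ZMod L, ((T i) ^ L).trace.re :=
  fun L _ hL _ _ _ T u hT hu =>
    _root_.Summit.QuantumFields.QCD.Cruxes.FlatCellOptimal.Diamag.stub_cyclicHolderEven L hL T u hT hu

/-- Stub B (`stub_staticSliceBoundAllN`): the time-direction static slice bound for `U(N)` fields, every `L ≥ 1`,
`m > −1`, GIVEN the Hölder step `hH` for this `L` and the chain-block lemma `hE`: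
`‖det D_W[V]‖^L ≤ ∏_s ‖det D_W[S⁰_s V]‖`, `S⁰_s V` = spatial links of slice `x₀ = s` on every slice, temporal links
`1` off the seam `x₀ = −1` and `−1` on it.  (Port of `…WilsonQuarkStability….stub_staticSliceBound`, `Fin 3 ↦ Fin N`,
`Odd L` dropped — it is not used in that proof.) -/
theorem stub_staticSliceBoundAllN :
    ∀ (N L : ℕ) [NeZero L],
      (∀ {k : Type} [Fintype k] [DecidableEq k] (T u : ZMod L → Matrix k k ℂ),
        (∀ i, (T i).PosDef) → (∀ i, u i ∈ Matrix.unitaryGroup k ℂ) →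
        ‖((List.range L).map fun i : ℕ => T (i : ZMod L) * u (i : ZMod L)).prod.trace‖ ^ L ≤
          ∏ i : ZMod L, ((T i) ^ L).trace.re) →
      (∀ {k : Type} [Fintype k] [DecidableEq k] (A Pp Pm W : Matrix k k ℂ),
        Pp + Pm = 1 → Pp * Pm = 0 → Pm * Pp = 0 → Ppᴴ = Pp → Pmᴴ = Pm →
        W ∈ Matrix.unitaryGroup k ℂ → W * Pp = Pp * W → W * Pm = Pm * W →
        ‖(A * Pm - Pp * W).det‖ = ‖(A * Pm - Pp).det‖) →
      ∀ (V : GaugeConfig 4 L (Matrix.unitaryGroup (Fin N) ℂ)) (m : ℝ), -1 < m →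
        ‖(wilsonDirac (unitaryFundamentalRep (Fin N) ℂ) V m 1).det‖ ^ L ≤
          ∏ s : ZMod L, ‖(wilsonDirac (unitaryFundamentalRep (Fin N) ℂ)
            (fun e : Edge 4 L => if e.2 = 0 then (if e.1 0 = -1 then (-1 : Matrix.unitaryGroup (Fin N) ℂ) else 1)
              else V (Function.update e.1 0 s, e.2)) m 1).det‖ :=
  fun N L _ hH hE V m hm =>
    _root_.Summit.QuantumFields.QCD.Cruxes.FlatCellOptimal.Diamag.stub_staticSliceBoundAllN N L hH hE V m hm

/-- Stub C (`stub_staticIterateAllN`): four-axis iteration for `U(N)` fields — from the time-direction static slice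
bound for every field (hypothesis) to domination by the all-seams antiperiodic pattern, `m > −1`.  (Port of
`…WilsonQuarkStability….stub_staticIterate`, `Fin 3 ↦ Fin N`; hypercubic covariance `det_wilsonDirac_swap` is
already `N`-generic.) -/
theorem stub_staticIterateAllN :
    ∀ (N L : ℕ) [NeZero L],
      (∀ (V : GaugeConfig 4 L (Matrix.unitaryGroup (Fin N) ℂ)) (m : ℝ), -1 < m →
        ‖(wilsonDirac (unitaryFundamentalRep (Fin N) ℂ) V m 1).det‖ ^ L ≤
          ∏ s : ZMod L, ‖(wilsonDirac (unitaryFundamentalRep (Fin N) ℂ)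
            (fun e : Edge 4 L => if e.2 = 0 then (if e.1 0 = -1 then (-1 : Matrix.unitaryGroup (Fin N) ℂ) else 1)
              else V (Function.update e.1 0 s, e.2)) m 1).det‖) →
      ∀ (V : GaugeConfig 4 L (Matrix.unitaryGroup (Fin N) ℂ)) (m : ℝ), -1 < m →
        ‖(wilsonDirac (unitaryFundamentalRep (Fin N) ℂ) V m 1).det‖ ≤
          ‖(wilsonDirac (unitaryFundamentalRep (Fin N) ℂ)
            (fun e : Edge 4 L => if e.1 e.2 = -1 then (-1 : Matrix.unitaryGroup (Fin N) ℂ) else 1) m 1).det‖ :=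
  fun N L _ hS V m hm =>
    _root_.Summit.QuantumFields.QCD.Cruxes.FlatCellOptimal.Diamag.stub_staticIterateAllN N L hS V m hm

/-! ### Name-keyed aliases of the registered statements — the hypotheses of `FlatCellOptimal_of` -/
namespace __Registered

/-- Alias of the statement of `stub_cyclicHolderEven`. -/
abbrev stub_cyclicHolderEven : Prop :=
  ∀ (L : ℕ) [NeZero L], Even L → ∀ {k : Type} [Fintype k] [DecidableEq k] (T u : ZMod L → Matrix k k ℂ),
    (∀ i, (T i).PosDef) → (∀ i, u i ∈ Matrix.unitaryGroup k ℂ) →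
    ‖((List.range L).map fun i : ℕ => T (i : ZMod L) * u (i : ZMod L)).prod.trace‖ ^ L ≤
      ∏ i : ZMod L, ((T i) ^ L).trace.re

/-- Alias of the statement of `stub_staticSliceBoundAllN`. -/
abbrev stub_staticSliceBoundAllN : Prop :=
  ∀ (N L : ℕ) [NeZero L],
    (∀ {k : Type} [Fintype k] [DecidableEq k] (T u : ZMod L → Matrix k k ℂ),
      (∀ i, (T i).PosDef) → (∀ i, u i ∈ Matrix.unitaryGroup k ℂ) →
      ‖((List.range L).map fun i : ℕ => T (i : ZMod L) * u (i : ZMod L)).prod.trace‖ ^ L ≤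
        ∏ i : ZMod L, ((T i) ^ L).trace.re) →
    (∀ {k : Type} [Fintype k] [DecidableEq k] (A Pp Pm W : Matrix k k ℂ),
      Pp + Pm = 1 → Pp * Pm = 0 → Pm * Pp = 0 → Ppᴴ = Pp → Pmᴴ = Pm →
      W ∈ Matrix.unitaryGroup k ℂ → W * Pp = Pp * W → W * Pm = Pm * W →
      ‖(A * Pm - Pp * W).det‖ = ‖(A * Pm - Pp).det‖) →
    ∀ (V : GaugeConfig 4 L (Matrix.unitaryGroup (Fin N) ℂ)) (m : ℝ), -1 < m →
      ‖(wilsonDirac (unitaryFundamentalRep (Fin N) ℂ) V m 1).det‖ ^ L ≤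
        ∏ s : ZMod L, ‖(wilsonDirac (unitaryFundamentalRep (Fin N) ℂ)
          (fun e : Edge 4 L => if e.2 = 0 then (if e.1 0 = -1 then (-1 : Matrix.unitaryGroup (Fin N) ℂ) else 1)
            else V (Function.update e.1 0 s, e.2)) m 1).det‖

/-- Alias of the statement of `stub_staticIterateAllN`. -/
abbrev stub_staticIterateAllN : Prop :=
  ∀ (N L : ℕ) [NeZero L],
    (∀ (V : GaugeConfig 4 L (Matrix.unitaryGroup (Fin N) ℂ)) (m : ℝ), -1 < m →
      ‖(wilsonDirac (unitaryFundamentalRep (Fin N) ℂ) V m 1).det‖ ^ L ≤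
        ∏ s : ZMod L, ‖(wilsonDirac (unitaryFundamentalRep (Fin N) ℂ)
          (fun e : Edge 4 L => if e.2 = 0 then (if e.1 0 = -1 then (-1 : Matrix.unitaryGroup (Fin N) ℂ) else 1)
            else V (Function.update e.1 0 s, e.2)) m 1).det‖) →
    ∀ (V : GaugeConfig 4 L (Matrix.unitaryGroup (Fin N) ℂ)) (m : ℝ), -1 < m →
      ‖(wilsonDirac (unitaryFundamentalRep (Fin N) ℂ) V m 1).det‖ ≤
        ‖(wilsonDirac (unitaryFundamentalRep (Fin N) ℂ)
          (fun e : Edge 4 L => if e.1 e.2 = -1 then (-1 : Matrix.unitaryGroup (Fin N) ℂ) else 1) m 1).det‖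

end __Registered

/-! ## Sorry-free compositions -/

/-- **The diamagnetic inequality on even tori from the three stubs** (with the tree's chain-block lemma
`stub_normDetChainBlock`, crux 9736). -/
theorem diamagneticEven_of (hA : __Registered.stub_cyclicHolderEven) (hB : __Registered.stub_staticSliceBoundAllN)
    (hC : __Registered.stub_staticIterateAllN) : DiamagneticEven := by
  intro N L _ hL V m hm
  refine hC N L (fun W m' hm' => hB N L (fun T u hT hu => hA L hL T u hT hu) ?_ W m' hm') V m hm
  intro k _ _ A Pp Pm W' h1 h2 h3 h4 h5 h6 h7 h8
  exact Summit.QuantumFields.QCD.Cruxes.WilsonQuarkStability.FreeTangentLandauChessboard.stub_normDetChainBlock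
    A Pp Pm W' h1 h2 h3 h4 h5 h6 h7 h8

/-- Seam convention: on `ZMod L` (`L ≠ 0`), `x.val + 1 = L ↔ x = -1`. -/
theorem val_add_one_eq_iff {L : ℕ} [NeZero L] (x : ZMod L) : x.val + 1 = L ↔ x = -1 := by
  obtain ⟨n, hn⟩ : ∃ n, L = n + 1 := Nat.exists_eq_succ_of_ne_zero (NeZero.ne L)
  subst hn
  constructor
  · intro h
    have h1 : ((x.val + 1 : ℕ) : ZMod (n + 1)) = 0 := by
      rw [h]
      exact ZMod.natCast_self _
    rw [Nat.cast_add, Nat.cast_one, ZMod.natCast_zmod_val] at h1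
    exact eq_neg_of_add_eq_zero_left h1
  · rintro rfl
    rw [ZMod.val_neg_one]

/-- The antiperiodically twisted unit field of the crux IS the all-seams pattern of the diamagnetic inequality. -/
theorem apTwist_one_eq {N L : ℕ} [NeZero L] :
    (fun e : Edge 4 L => if (e.1 e.2).val + 1 = L then -(1 : GaugeConfig 4 L (Matrix.unitaryGroup (Fin N) ℂ)) e
      else (1 : GaugeConfig 4 L (Matrix.unitaryGroup (Fin N) ℂ)) e) =
    (fun e : Edge 4 L => if e.1 e.2 = -1 then (-1 : Matrix.unitaryGroup (Fin N) ℂ) else 1) := by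
  funext e
  by_cases h : e.1 e.2 = -1
  · rw [if_pos h, if_pos ((val_add_one_eq_iff _).2 h)]; rfl
  · rw [if_neg h, if_neg (fun h' => h ((val_add_one_eq_iff _).1 h'))]; rfl

/-- **Diamagnetism in the crux's currency**: `‖dAP m V‖ ≤ ‖dAP m 1‖` for EVERY field `V` (even `L`, `m > −1`). -/
theorem norm_dAP_le (hD : DiamagneticEven) {N L : ℕ} [NeZero L] (hL : Even L) {m : ℝ} (hm : -1 < m)
    (V : GaugeConfig 4 L (Matrix.unitaryGroup (Fin N) ℂ)) :
    ‖dAP m V‖ ≤ ‖dAP m (1 : GaugeConfig 4 L (Matrix.unitaryGroup (Fin N) ℂ))‖ := by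
  have h := hD N L hL (fun e : Edge 4 L => if (e.1 e.2).val + 1 = L then -V e else V e) m hm
  have e1 : dAP m (1 : GaugeConfig 4 L (Matrix.unitaryGroup (Fin N) ℂ)) =
      (wilsonDirac (unitaryFundamentalRep (Fin N) ℂ)
        (fun e : Edge 4 L => if e.1 e.2 = -1 then (-1 : Matrix.unitaryGroup (Fin N) ℂ) else 1) m 1).det := by
    simp only [dAP]
    rw [apTwist_one_eq]
  rw [e1]
  exact h

/-- The free antiperiodic determinant is real and `≥ 0` for `m > -1` (the proved `QuarkChessboard` at
`U = 1`, whose tiling is `1`), hence `‖dAP m 1‖ = Re dAP m 1`. -/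
theorem norm_dAP_one {N L : ℕ} [NeZero L] (hL : Even L) (h4 : 4 ≤ L) {m : ℝ} (hm : -1 < m) :
    ‖dAP m (1 : GaugeConfig 4 L (Matrix.unitaryGroup (Fin N) ℂ))‖ =
      (dAP m (1 : GaugeConfig 4 L (Matrix.unitaryGroup (Fin N) ℂ))).re := by
  have hQC := Summit.QuantumFields.QCD.Theorems.wilsonQuarkChessboardQuarkChessboard_proof N L hL h4
    (1 : GaugeConfig 4 L (Matrix.unitaryGroup (Fin N) ℂ)) m hm
  obtain ⟨hReal, -⟩ := hQC
  obtain ⟨hre, him⟩ := hReal (0 : Site 4 L)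
  have e1 : dAP m (1 : GaugeConfig 4 L (Matrix.unitaryGroup (Fin N) ℂ)) =
      (wilsonDirac (unitaryFundamentalRep (Fin N) ℂ)
        (fun e : Edge 4 L => if (e.1 e.2).val + 1 = L then (-1 : Matrix.unitaryGroup (Fin N) ℂ) else 1)
        m 1).det := by
    simp only [dAP, Pi.one_apply]
  have hre' : 0 ≤ (wilsonDirac (unitaryFundamentalRep (Fin N) ℂ)
      (fun e : Edge 4 L => if (e.1 e.2).val + 1 = L then (-1 : Matrix.unitaryGroup (Fin N) ℂ) else 1)
      m 1).det.re := by
    simpa using hre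
  have him' : (wilsonDirac (unitaryFundamentalRep (Fin N) ℂ)
      (fun e : Edge 4 L => if (e.1 e.2).val + 1 = L then (-1 : Matrix.unitaryGroup (Fin N) ℂ) else 1)
      m 1).det.im = 0 := by
    simpa using him
  rw [e1]
  set z : ℂ := (wilsonDirac (unitaryFundamentalRep (Fin N) ℂ)
      (fun e : Edge 4 L => if (e.1 e.2).val + 1 = L then (-1 : Matrix.unitaryGroup (Fin N) ℂ) else 1)
      m 1).det with hz
  have hzeq : z = ((z.re : ℝ) : ℂ) := Complex.ext (by simp) (by simp [him'])
  rw [hzeq]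
  simp [abs_of_nonneg hre']

/-- **K for every tiling and every field, unconditionally in the flatness**: `Re dAP m (tile c U) ≤ Re dAP m 1`
for even `L ≥ 4` and `−1 < m`, from the diamagnetic inequality. -/
theorem re_dAP_tile_le (hD : DiamagneticEven) {N L : ℕ} [NeZero L] (hL : Even L) (h4 : 4 ≤ L) {m : ℝ}
    (hm : -1 < m) (U : GaugeConfig 4 L (Matrix.unitaryGroup (Fin N) ℂ)) (c : Site 4 L) :
    (dAP m (tile c U)).re ≤ (dAP m (1 : GaugeConfig 4 L (Matrix.unitaryGroup (Fin N) ℂ))).re :=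
  ((Complex.re_le_norm _).trans (norm_dAP_le hD hL hm (tile c U))).trans_eq (norm_dAP_one hL h4 hm)

/-- The local half in norm form from diamagnetism (`η = δ = 1`; kernel-clean, supersedes the computational p169601). -/
theorem localNormGain_of_diamag (hD : DiamagneticEven) : LocalNormGain := by
  refine ⟨1, one_pos, 1, one_pos, ?_⟩
  intro N L _ hL _ U c m hm₁ _ _
  exact norm_dAP_le hD hL (by linarith) (tile c U)

/-- The far half from diamagnetism (`δ = 1` for every `η`; the deficit hypothesis is not needed). -/
theorem farFromFlat_of_diamag (hD : DiamagneticEven) : FarFromFlat := by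
  intro η _
  refine ⟨1, one_pos, ?_⟩
  intro N L _ hL h4 U c m hm₁ _ _
  exact re_dAP_tile_le hD hL h4 (by linarith) U c

/-- The local half in Re form from diamagnetism. -/
theorem localFlatOptimum_of_diamag (hD : DiamagneticEven) : LocalFlatOptimum := by
  refine ⟨1, one_pos, 1, one_pos, ?_⟩
  intro N L _ hL h4 U c m hm₁ _ _
  exact re_dAP_tile_le hD hL h4 (by linarith) U c

/-! ## Composition: the crux BY NAME (no `sorry` below) -/

/-- **FlatCellOptimal_of** — the crux from the three registered port stubs: `δ := 1`, and for `−1 < m < 1`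
every tiling determinant is dominated by the free antiperiodic one (`re_dAP_tile_le`).  Kernel-clean. -/
theorem FlatCellOptimal_of (hA : __Registered.stub_cyclicHolderEven) (hB : __Registered.stub_staticSliceBoundAllN)
    (hC : __Registered.stub_staticIterateAllN) :
    Summit.QuantumFields.QCD.Theses.WilsonQuarkChessboard.FlatCellOptimal := by
  have hD : DiamagneticEven := diamagneticEven_of hA hB hC
  refine ⟨1, one_pos, ?_⟩
  intro N L _ hL h4 U c m hm₁ hm₂
  show (dAP m (tile c U)).re ≤ (dAP m (1 : GaugeConfig 4 L (Matrix.unitaryGroup (Fin N) ℂ))).re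
  exact re_dAP_tile_le hD hL h4 (by linarith) U c

/-- Wiring check: the stubs feed the skeleton theorem as stated. -/
example : Summit.QuantumFields.QCD.Theses.WilsonQuarkChessboard.FlatCellOptimal :=
  FlatCellOptimal_of stub_cyclicHolderEven stub_staticSliceBoundAllN stub_staticIterateAllN

/-- The two-halves form `LocalFlatOptimum → FarFromFlat → FlatCellOptimal` (v1's skeleton theorem), kept as an
`example` so that `FlatCellOptimal_of` stays the only theorem concluding the crux. -/
example (hloc : LocalFlatOptimum) (hfar : FarFromFlat) :
    Summit.QuantumFields.QCD.Theses.WilsonQuarkChessboard.FlatCellOptimal := by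
  obtain ⟨η, hη, δ₁, hδ₁, H₁⟩ := hloc
  obtain ⟨δ₂, hδ₂, H₂⟩ := hfar η hη
  refine ⟨min δ₁ δ₂, lt_min hδ₁ hδ₂, ?_⟩
  intro N L _ hL h4 U c m hm₁ hm₂
  show (dAP m (tile c U)).re ≤ (dAP m (1 : GaugeConfig 4 L (Matrix.unitaryGroup (Fin N) ℂ))).re
  by_cases hflat : ∀ (x : Site 4 L) (i j : Fin 4), deficit (tile c U) x i j < η
  · exact H₁ N L hL h4 U c m (lt_of_le_of_lt (neg_le_neg (min_le_left δ₁ δ₂)) hm₁)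
      (lt_of_lt_of_le hm₂ (min_le_left δ₁ δ₂)) hflat
  · push Not at hflat
    obtain ⟨x, i, j, hx⟩ := hflat
    exact H₂ N L hL h4 U c m (lt_of_le_of_lt (neg_le_neg (min_le_right δ₁ δ₂)) hm₁)
      (lt_of_lt_of_le hm₂ (min_le_right δ₁ δ₂)) ⟨x, i, j, hx⟩

/-! ## The cut loses nothing: both halves are consequences of the crux -/

/-- K ⟹ the local half. -/
theorem localFlatOptimum_of_flatCellOptimal
    (hK : Summit.QuantumFields.QCD.Theses.WilsonQuarkChessboard.FlatCellOptimal) :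
    LocalFlatOptimum := by
  obtain ⟨δ, hδ, H⟩ := hK
  refine ⟨1, one_pos, δ, hδ, ?_⟩
  intro N L _ hL h4 U c m hm₁ hm₂ _
  exact H N L hL h4 U c m hm₁ hm₂

/-- K ⟹ the far half. -/
theorem farFromFlat_of_flatCellOptimal
    (hK : Summit.QuantumFields.QCD.Theses.WilsonQuarkChessboard.FlatCellOptimal) :
    FarFromFlat := by
  obtain ⟨δ, hδ, H⟩ := hK
  intro η _
  refine ⟨δ, hδ, ?_⟩
  intro N L _ hL h4 U c m hm₁ hm₂ _
  exact H N L hL h4 U c m hm₁ hm₂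

end Summit.QuantumFields.QCD.Cruxes.FlatCellOptimal.Birth

end
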